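import Summits.NavierStokesRegularity.NavierStokesRegularity.Theorems.EulerZoomLiouvillePowerGaugeEulerLiouvilleBreatherProfileGradient

/-!
# Crux `EulerZoomLiouville.PowerGaugeEulerLiouville` (stmt-NavierStokesRegularity-19832), line `logtime-breathers` (T3, weak residue):
# profile data of a WEAK log-time breather — measurability, the weak gradient in profile variables, `E`-growth

Width seat `ns-ezl-w4` (g3; weak breather rigidity, file B1).  A member `(u, p, H, c₀)` of Seregin's power-gauged ancient Euler class
(`H` a weak spatial gradient of `u` on the slab `(−∞,0) × ℝ³`) with `u(τ, y) = e^{cτ} V(e^{−cτ} y)` for all `τ < 0` — NO classical,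
tameness or energy hypothesis — has, in the profile variable `z = e^{−cτ} y`:

* `BreatherWeak.aestronglyMeasurable_profile` — `V` is a.e.-strongly measurable (a good slice, undone by the dilation);
* `BreatherWeak.exists_profileGradient_ae` — a profile gradient `G`: a weak derivative of `V` on `ℝ³`, a.e.-strongly measurable, with
  `H(τ) = G(e^{−cτ}·)` a.e. for a.e. `τ < 0` (a.e. slice of `H` is a weak derivative of `u(τ) = e^{cτ}V(e^{−cτ}·)` on `ℝ³`,
  `ae_hasWeakFDerivOn_slice_slab`; affine covariance `Past.hasWeakFDerivOn_profile_of_shiftedSlice`; uniqueness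
  `HasWeakFDerivOn.unique_holds` transported along the dilation) — the weak form of `∇u(τ) = ∇V(e^{−cτ}·)`;
* `BreatherWeak.profile_gradient_growth_of_gaugeE` — the `E`-gauge `a^{ρ}E(a) ≤ c₀` gives `∫_{B_L}|G|²_F ≤ C L^{1−ρ}` for `L ≥ 2`
  (verbatim the classical `BreatherRigidity.profile_gradient_growth_of_gaugeE` with `∇V ↦ G`).

(The `A`-growth `∫_{B_L}|V|² ≤ e^{(4+2ρ)|c|}c₀L^{1−2ρ}` for all `L > 0` is the tree's u-only `BreatherRigidity.lintegral_ball_profile_le`.)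
WHAT THIS IS NOT: not NS regularity, not the crux — data bricks for the WEAK breather-rigidity member (sequels `…BreatherWeakPressure`,
`…BreatherWeakLEI`, `…BreatherWeakRigidity`); `--supports` stmt-19832. [folklore]
-/

noncomputable section

set_option linter.dupNamespace false

open MeasureTheory Set Filter Topology Metric Function TopologicalSpace
open scoped ENNReal NNReal RealInnerProductSpace ContDiff

namespace Summit.NavierStokesRegularity.NavierStokesRegularity.Theorems.PowerGaugeEulerLiouville

open Literature.Analysis Literature.Analysis.FunctionSpaces Literature.Analysis.FluidPDE

namespace BreatherWeak

variable {u : ℝ → EuclideanSpace ℝ (Fin 3) → EuclideanSpace ℝ (Fin 3)} {p : ℝ → EuclideanSpace ℝ (Fin 3) → ℝ}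
  {H : ℝ → EuclideanSpace ℝ (Fin 3) → EuclideanSpace ℝ (Fin 3) →L[ℝ] EuclideanSpace ℝ (Fin 3)}
  {c : ℝ} {V : EuclideanSpace ℝ (Fin 3) → EuclideanSpace ℝ (Fin 3)}

/-! ### Measurability of the profile -/

/-- **The profile of a weak breather is a.e.-strongly measurable**: some slice `u(τ₀)` (`τ₀ < 0`) is a.e.-strongly measurable
(Fubini) and `V = e^{−cτ₀} u(τ₀, e^{cτ₀}·)` (`BreatherRigidity.profile_eq`), a dilation being quasi-measure-preserving. [folklore] -/
theorem aestronglyMeasurable_profile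
    (hum : AEStronglyMeasurable (uncurry u)
      (volume.restrict (Iio (0 : ℝ) ×ˢ (univ : Set (EuclideanSpace ℝ (Fin 3))))))
    (hbr : ∀ τ : ℝ, τ < 0 → ∀ y, u τ y = Real.exp (c * τ) • V (Real.exp (-(c * τ)) • y)) :
    AEStronglyMeasurable V volume := by
  -- adapted from `aestronglyMeasurable_profile` (…SelfSimilarGauges)
  rw [Measure.volume_eq_prod, ← Measure.prod_restrict, Measure.restrict_univ] at hum
  have h1 := hum.prodMk_left
  haveI : (ae ((volume : Measure ℝ).restrict (Iio (0 : ℝ)))).NeBot := by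
    rw [ae_neBot, Ne, Measure.restrict_eq_zero]
    simp
  have h2 : ∀ᵐ τ ∂((volume : Measure ℝ).restrict (Iio (0 : ℝ))), τ < 0 :=
    (ae_restrict_mem measurableSet_Iio)
  obtain ⟨τ₀, hτ₀m, hτ₀⟩ := (h1.and h2).exists
  have hslice : AEStronglyMeasurable (u τ₀) volume := hτ₀m
  rw [BreatherRigidity.profile_eq hbr hτ₀]
  have h3 : AEStronglyMeasurable (fun z => u τ₀ (Real.exp (c * τ₀) • z)) volume :=
    hslice.comp_quasiMeasurePreserving (quasiMeasurePreserving_smul (Real.exp_pos (c * τ₀)).ne')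
  exact h3.const_smul (Real.exp (-(c * τ₀)))

/-! ### The weak gradient in profile variables -/

/-- **Identification of the weak gradient of a WEAK breather.**  Let `H` be a weak spatial gradient of `u` on the slab
`(−∞,0) × ℝ³` and `u(τ, y) = e^{cτ} V(e^{−cτ} y)` for all `τ < 0`.  Then there is a profile gradient `G` — a weak derivative of
`V` on `ℝ³`, a.e.-strongly measurable — with `H(τ) = G(e^{−cτ}·)` a.e. on `ℝ³` for a.e. `τ < 0` (the weak form of
`∇u(τ, y) = ∇V(e^{−cτ}y)`; template `Past.exists_profileGradient_ae_of_past`). [folklore] -/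
theorem exists_profileGradient_ae
    (hH : HasWeakSpatialGradientOn (slab (EuclideanSpace ℝ (Fin 3)) (Iio 0) isOpen_Iio) u H)
    (hbr : ∀ τ : ℝ, τ < 0 → ∀ y, u τ y = Real.exp (c * τ) • V (Real.exp (-(c * τ)) • y)) :
    ∃ G : EuclideanSpace ℝ (Fin 3) → EuclideanSpace ℝ (Fin 3) →L[ℝ] EuclideanSpace ℝ (Fin 3),
      AEStronglyMeasurable G volume ∧
      HasWeakFDerivOn (⊤ : Opens (EuclideanSpace ℝ (Fin 3))) volume V G ∧
      ∀ᵐ τ ∂((volume : Measure ℝ).restrict (Iio (0 : ℝ))),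
        H τ =ᵐ[volume] fun x => G (Real.exp (-(c * τ)) • x) := by
  -- adapted from `Past.exists_profileGradient_ae_of_past` (…SelfSimilarPastProfileGradient, ns-ezl-w1)
  -- (1) a.e. slice below `0` is a weak derivative on `ℝ³`
  have hslice : ∀ᵐ τ ∂((volume : Measure ℝ).restrict (Iio (0 : ℝ))),
      HasWeakFDerivOn (⊤ : Opens (EuclideanSpace ℝ (Fin 3))) volume (u τ) (H τ) := by
    have hU : (Iio (0 : ℝ)) = ⋃ n : ℕ, Ioo (-((n : ℝ) + 1)) 0 := by
      refine subset_antisymm (fun t ht => mem_iUnion.2 ?_) (iUnion_subset fun n t ht => ht.2)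
      obtain ⟨n, hn⟩ := exists_nat_gt (-t)
      exact ⟨n, ⟨by linarith, ht⟩⟩
    rw [hU, ae_restrict_iUnion_iff]
    intro n
    have hn : HasWeakSpatialGradientOn
        (slab (EuclideanSpace ℝ (Fin 3)) (Ioo (-((n : ℝ) + 1)) 0) isOpen_Ioo) u H :=
      hH.mono (slab_mono Ioo_subset_Iio_self)
    exact hn.ae_hasWeakFDerivOn_slice_slab
  -- (2) a.e. slice of `H` is a.e.-strongly measurable; `τ < 0` a.e.
  have hHm : AEStronglyMeasurable (uncurry H)
      (((volume : Measure ℝ).restrict (Iio (0 : ℝ))).prod (volume : Measure (EuclideanSpace ℝ (Fin 3)))) := by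
    have := hH.locallyIntegrableOn_grad.aestronglyMeasurable
    rw [coe_slab, Measure.volume_eq_prod, ← Measure.prod_restrict, Measure.restrict_univ] at this
    exact this
  have hmeas : ∀ᵐ τ ∂((volume : Measure ℝ).restrict (Iio (0 : ℝ))),
      AEStronglyMeasurable (H τ) volume := hHm.prodMk_left
  have hlt : ∀ᵐ τ ∂((volume : Measure ℝ).restrict (Iio (0 : ℝ))), τ < 0 :=
    ae_restrict_mem measurableSet_Iio
  haveI : (ae ((volume : Measure ℝ).restrict (Iio (0 : ℝ)))).NeBot := by
    rw [ae_neBot, Ne, Measure.restrict_eq_zero]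
    simp
  obtain ⟨τ₀, ⟨hW₀, hm₀⟩, hτ₀⟩ := ((hslice.and hmeas).and hlt).exists
  -- (3) the profile gradient from the slice at `τ₀ < 0`
  have huslice : ∀ {τ : ℝ}, τ < 0 →
      u τ = fun x => Real.exp (c * τ) • V (Real.exp (-(c * τ)) • (x - 0)) := by
    intro τ hτ
    funext x
    rw [hbr τ hτ x, sub_zero]
  set c₀ : ℝ := Real.exp (c * τ₀) with hc₀
  set d₀ : ℝ := Real.exp (-(c * τ₀)) with hd₀
  have hc₀p : 0 < c₀ := Real.exp_pos _
  have hd₀p : 0 < d₀ := Real.exp_pos _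
  set G : EuclideanSpace ℝ (Fin 3) → EuclideanSpace ℝ (Fin 3) →L[ℝ] EuclideanSpace ℝ (Fin 3) :=
    fun y => c₀⁻¹ • (d₀⁻¹ • H τ₀ (0 + d₀⁻¹ • y)) with hG
  have hVG : HasWeakFDerivOn (⊤ : Opens (EuclideanSpace ℝ (Fin 3))) volume V G := by
    rw [huslice hτ₀] at hW₀
    exact Past.hasWeakFDerivOn_profile_of_shiftedSlice hc₀p hd₀p 0 hW₀
  have hGm : AEStronglyMeasurable G volume := by
    have h1 : AEStronglyMeasurable (fun y => H τ₀ (0 + d₀⁻¹ • y)) volume :=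
      hm₀.comp_quasiMeasurePreserving (Past.quasiMeasurePreserving_add_smul (inv_pos.2 hd₀p).ne' 0)
    exact (h1.const_smul d₀⁻¹).const_smul c₀⁻¹
  refine ⟨G, hGm, hVG, ?_⟩
  -- (4) for every good `τ < 0`: uniqueness of the weak derivative of `V`, transported along `x ↦ e^{−cτ} x`
  filter_upwards [hslice, hlt] with τ hWτ hτ
  set c₁ : ℝ := Real.exp (c * τ) with hc₁def
  set d : ℝ := Real.exp (-(c * τ)) with hddef
  have hcp : 0 < c₁ := Real.exp_pos _
  have hdp : 0 < d := Real.exp_pos _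
  rw [huslice hτ] at hWτ
  have hVG' := Past.hasWeakFDerivOn_profile_of_shiftedSlice hcp hdp 0 hWτ
  have huniq := HasWeakFDerivOn.unique_holds hVG' hVG
  rw [Opens.coe_top, Measure.restrict_univ] at huniq
  have ht := (Past.quasiMeasurePreserving_smul_sub hdp.ne' 0).ae_eq_comp huniq
  filter_upwards [ht] with x hx
  simp only [comp_apply, smul_smul, inv_mul_cancel₀ hdp.ne', one_smul, sub_zero, zero_add] at hx
  -- `hx : (c₁⁻¹ * d⁻¹) • H τ x = G (d • x)`
  have hcd : c₁ * d = 1 := by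
    rw [hc₁def, hddef, ← Real.exp_add, add_neg_cancel, Real.exp_zero]
  calc H τ x = (c₁ * d) • ((c₁⁻¹ * d⁻¹) • H τ x) := by
        rw [smul_smul, show c₁ * d * (c₁⁻¹ * d⁻¹) = 1 by field_simp, one_smul]
    _ = G (Real.exp (-(c * τ)) • x) := by rw [hx, hcd, one_smul]

/-! ### `E`-growth of the profile gradient at large scales -/

/-- **THE `E`-GAUGE OF A WEAK BREATHER IN PROFILE VARIABLES (large scales).**  Let `H` be a.e.-strongly measurable on the slab with
`H(τ) = G(e^{−cτ}·)` a.e. for a.e. `τ < 0` (output of `exists_profileGradient_ae`) and `a^{ρ} E(a; 0; H) ≤ c₀` for all `a > 0`.  Then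
`∫_{B_L} |G|²_F ≤ e^{6|c|} (e^{2|c|})^{1−ρ} c₀ · L^{1−ρ}` for every `L ≥ 2` (window `(−2,−1) × B_a ⊆ Q_a(0,0)`, `a = e^{2|c|} L`, Tonelli,
slice dilation; verbatim the classical `BreatherRigidity.profile_gradient_growth_of_gaugeE` with `∇V ↦ G`). [folklore] -/
theorem profile_gradient_growth_of_gaugeE {ρ : ℝ} {c₀ : ℝ≥0}
    {G : EuclideanSpace ℝ (Fin 3) → EuclideanSpace ℝ (Fin 3) →L[ℝ] EuclideanSpace ℝ (Fin 3)}
    (hHm : AEStronglyMeasurable (uncurry H)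
      (volume.restrict (Iio (0 : ℝ) ×ˢ (univ : Set (EuclideanSpace ℝ (Fin 3))))))
    (hHV : ∀ᵐ τ ∂((volume : Measure ℝ).restrict (Iio (0 : ℝ))),
      H τ =ᵐ[volume] fun x => G (Real.exp (-(c * τ)) • x))
    (hE : ∀ a : ℝ, 0 < a →
      ENNReal.ofReal (a ^ ρ) * cknE a (0 : ℝ × EuclideanSpace ℝ (Fin 3)) H ≤ (c₀ : ℝ≥0∞)) :
    ∀ L : ℝ, 2 ≤ L →
      ∫⁻ y in ball (0 : EuclideanSpace ℝ (Fin 3)) L, ENNReal.ofReal (frobeniusNormSq (G y)) ≤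
        ENNReal.ofReal (Real.exp (6 * |c|) * Real.exp (2 * |c|) ^ (1 - ρ)) * (c₀ : ℝ≥0∞) *
          ENNReal.ofReal (L ^ (1 - ρ)) := by
  -- adapted from `BreatherRigidity.profile_gradient_growth_of_gaugeE` (…BreatherProfileGradient, ns-ezl-w4 g2), `fderiv ℝ V ↦ G`
  intro L hL
  have hfm : Measurable fun L : EuclideanSpace ℝ (Fin 3) →L[ℝ] EuclideanSpace ℝ (Fin 3) =>
      ENNReal.ofReal (frobeniusNormSq L) :=
    (SereginZajaczkowski2007.continuous_frobeniusNormSq).measurable.ennreal_ofReal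
  have hL0 : 0 < L := by linarith
  have he1 : 1 ≤ Real.exp (2 * |c|) := Real.one_le_exp (by positivity)
  -- ### the radius `a = e^{2|c|} L`
  set a : ℝ := Real.exp (2 * |c|) * L with ha
  have haL : L ≤ a := by rw [ha]; nlinarith
  have ha0 : 0 < a := by linarith
  have ha2 : (2 : ℝ) ≤ a ^ 2 := by nlinarith
  -- ### (1) the gauge: `X = ∫∫_{Q_a} |H|²_F ≤ a^{1−ρ} c₀`
  set X : ℝ≥0∞ := ∫⁻ q in parabolicCylinder a (0 : ℝ × EuclideanSpace ℝ (Fin 3)),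
    ENNReal.ofReal (frobeniusNormSq (H q.1 q.2)) with hX
  have hXle : X ≤ ENNReal.ofReal (a ^ (1 - ρ)) * (c₀ : ℝ≥0∞) := by
    have h1 := hE a ha0
    unfold cknE at h1
    have hB0 : ENNReal.ofReal (a ^ ρ) ≠ 0 := by
      rw [ENNReal.ofReal_ne_zero_iff]; exact Real.rpow_pos_of_pos ha0 _
    have hA0 : ENNReal.ofReal a ≠ 0 := by rw [ENNReal.ofReal_ne_zero_iff]; exact ha0
    have key : X = ENNReal.ofReal a * (ENNReal.ofReal (a ^ ρ))⁻¹ *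
        (ENNReal.ofReal (a ^ ρ) * ((ENNReal.ofReal a)⁻¹ * X)) := by
      rw [← mul_assoc, mul_assoc (ENNReal.ofReal a), ENNReal.inv_mul_cancel hB0 ENNReal.ofReal_ne_top,
        mul_one, ← mul_assoc, ENNReal.mul_inv_cancel hA0 ENNReal.ofReal_ne_top, one_mul]
    calc X = _ := key
      _ ≤ ENNReal.ofReal a * (ENNReal.ofReal (a ^ ρ))⁻¹ * (c₀ : ℝ≥0∞) := by gcongr
      _ = ENNReal.ofReal (a ^ (1 - ρ)) * (c₀ : ℝ≥0∞) := by
          rw [← ENNReal.ofReal_inv_of_pos (Real.rpow_pos_of_pos ha0 _), ← ENNReal.ofReal_mul ha0.le]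
          congr 2
          rw [Real.rpow_sub ha0, Real.rpow_one, div_eq_mul_inv]
  -- ### (2) the window `(−2, −1) × B_a` inside `Q_a(0,0)`
  have hWsub : Ioo (-2 : ℝ) (-1) ×ˢ ball (0 : EuclideanSpace ℝ (Fin 3)) a ⊆
      parabolicCylinder a (0 : ℝ × EuclideanSpace ℝ (Fin 3)) := by
    intro q hq
    rw [mem_prod, mem_Ioo, mem_ball] at hq
    rw [mem_parabolicCylinder, Prod.fst_zero, Prod.snd_zero, zero_sub]
    exact ⟨⟨by linarith [hq.1.1], by linarith [hq.1.2]⟩, hq.2⟩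
  have hY : ∫⁻ q in Ioo (-2 : ℝ) (-1) ×ˢ ball (0 : EuclideanSpace ℝ (Fin 3)) a,
      ENNReal.ofReal (frobeniusNormSq (H q.1 q.2)) ≤ X :=
    lintegral_mono_set hWsub
  -- ### (3) Tonelli on the window
  have hHmW : AEMeasurable (fun q : ℝ × EuclideanSpace ℝ (Fin 3) =>
      ENNReal.ofReal (frobeniusNormSq (H q.1 q.2)))
      (((volume : Measure ℝ).restrict (Ioo (-2 : ℝ) (-1))).prod
        ((volume : Measure (EuclideanSpace ℝ (Fin 3))).restrict (ball 0 a))) := by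
    have hsub : Ioo (-2 : ℝ) (-1) ×ˢ ball (0 : EuclideanSpace ℝ (Fin 3)) a ⊆
        Iio (0 : ℝ) ×ˢ (univ : Set (EuclideanSpace ℝ (Fin 3))) :=
      prod_mono (fun t ht => by have := ht.2; rw [mem_Iio]; linarith) (subset_univ _)
    have := hfm.comp_aemeasurable (hHm.mono_measure (Measure.restrict_mono hsub le_rfl)).aemeasurable
    rwa [Measure.volume_eq_prod, ← Measure.prod_restrict] at this
  have hYeq : ∫⁻ q in Ioo (-2 : ℝ) (-1) ×ˢ ball (0 : EuclideanSpace ℝ (Fin 3)) a,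
        ENNReal.ofReal (frobeniusNormSq (H q.1 q.2)) =
      ∫⁻ τ in Ioo (-2 : ℝ) (-1), ∫⁻ x in ball (0 : EuclideanSpace ℝ (Fin 3)) a,
        ENNReal.ofReal (frobeniusNormSq (H τ x)) := by
    rw [Measure.volume_eq_prod, ← Measure.prod_restrict, lintegral_prod _ hHmW]
  -- ### (4) the a.e. lower bound on the slices of the window
  set J : ℝ≥0∞ := ∫⁻ y in ball (0 : EuclideanSpace ℝ (Fin 3)) L, ENNReal.ofReal (frobeniusNormSq (G y)) with hJ
  have hWT : Ioo (-2 : ℝ) (-1) ⊆ Iio 0 := fun t ht => by have := ht.2; rw [mem_Iio]; linarith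
  have hlow : ∀ᵐ τ ∂((volume : Measure ℝ).restrict (Ioo (-2 : ℝ) (-1))),
      ENNReal.ofReal (Real.exp (-(6 * |c|))) * J ≤
        ∫⁻ x in ball (0 : EuclideanSpace ℝ (Fin 3)) a, ENNReal.ofReal (frobeniusNormSq (H τ x)) := by
    filter_upwards [ae_restrict_of_ae_restrict_of_subset hWT hHV, ae_restrict_mem measurableSet_Ioo]
      with τ hτ hτW
    have hcτ : |c * τ| ≤ 2 * |c| := by
      rw [abs_mul]
      have : |τ| ≤ 2 := by rw [abs_le]; constructor <;> linarith [hτW.1, hτW.2]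
      nlinarith [abs_nonneg c]
    set d : ℝ := Real.exp (-(c * τ)) with hd
    have hd0 : 0 < d := Real.exp_pos _
    -- replace `H τ` by the dilated profile gradient on the ball
    have hcongr : ∫⁻ x in ball (0 : EuclideanSpace ℝ (Fin 3)) a, ENNReal.ofReal (frobeniusNormSq (H τ x)) =
        ∫⁻ x in ball (0 : EuclideanSpace ℝ (Fin 3)) a, ENNReal.ofReal (frobeniusNormSq (G (d • x))) :=
      lintegral_congr_ae (ae_restrict_of_ae (hτ.mono fun x hx => by simp only [hx, hd]))
    rw [hcongr]
    have hLa : L ≤ d * a := by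
      have h1 : Real.exp (-(2 * |c|)) ≤ d := by
        rw [hd, Real.exp_le_exp]; linarith [le_abs_self (c * τ), neg_abs_le (c * τ), hcτ]
      have h2 : Real.exp (-(2 * |c|)) * a = L := by
        rw [ha, ← mul_assoc, ← Real.exp_add, neg_add_cancel, Real.exp_zero, one_mul]
      rw [← h2]
      exact mul_le_mul_of_nonneg_right h1 ha0.le
    have hcoef : Real.exp (-(6 * |c|)) ≤ (d ^ 3)⁻¹ := by
      rw [hd, ← Real.exp_nat_mul, ← Real.exp_neg, Real.exp_le_exp]
      push_cast
      linarith [le_abs_self (c * τ), neg_abs_le (c * τ), hcτ]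
    calc ENNReal.ofReal (Real.exp (-(6 * |c|))) * J ≤ ENNReal.ofReal ((d ^ 3)⁻¹) * J :=
          mul_le_mul' (ENNReal.ofReal_le_ofReal hcoef) le_rfl
      _ ≤ _ := BreatherRigidity.lintegral_ball_frobeniusNormSq_dilate_ge hd0 G hLa
  -- ### (5) integrate the lower bound over the window (length `1`)
  have hvolW : volume (Ioo (-2 : ℝ) (-1)) = 1 := by
    rw [Real.volume_Ioo, show (-1 : ℝ) - -2 = 1 by ring, ENNReal.ofReal_one]
  have hJle : ENNReal.ofReal (Real.exp (-(6 * |c|))) * J ≤ X :=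
    calc ENNReal.ofReal (Real.exp (-(6 * |c|))) * J
        = ∫⁻ _ in Ioo (-2 : ℝ) (-1), ENNReal.ofReal (Real.exp (-(6 * |c|))) * J := by
          rw [setLIntegral_const, hvolW, mul_one]
      _ ≤ ∫⁻ τ in Ioo (-2 : ℝ) (-1), ∫⁻ x in ball (0 : EuclideanSpace ℝ (Fin 3)) a,
            ENNReal.ofReal (frobeniusNormSq (H τ x)) := lintegral_mono_ae hlow
      _ = _ := hYeq.symm
      _ ≤ X := hY
  -- ### (6) assemble
  have haρ : a ^ (1 - ρ) = Real.exp (2 * |c|) ^ (1 - ρ) * L ^ (1 - ρ) := by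
    rw [ha, Real.mul_rpow (Real.exp_pos _).le hL0.le]
  have hunit : ENNReal.ofReal (Real.exp (6 * |c|)) * ENNReal.ofReal (Real.exp (-(6 * |c|))) = 1 := by
    rw [← ENNReal.ofReal_mul (Real.exp_pos _).le, ← Real.exp_add, add_neg_cancel, Real.exp_zero, ENNReal.ofReal_one]
  calc J = ENNReal.ofReal (Real.exp (6 * |c|)) * (ENNReal.ofReal (Real.exp (-(6 * |c|))) * J) := by
        rw [← mul_assoc, hunit, one_mul]
    _ ≤ ENNReal.ofReal (Real.exp (6 * |c|)) * X := by gcongr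
    _ ≤ ENNReal.ofReal (Real.exp (6 * |c|)) * (ENNReal.ofReal (a ^ (1 - ρ)) * (c₀ : ℝ≥0∞)) := by gcongr
    _ = ENNReal.ofReal (Real.exp (6 * |c|) * Real.exp (2 * |c|) ^ (1 - ρ)) * (c₀ : ℝ≥0∞) *
          ENNReal.ofReal (L ^ (1 - ρ)) := by
        rw [haρ, ENNReal.ofReal_mul (by positivity), ENNReal.ofReal_mul (by positivity)]
        ring

end BreatherWeak

end Summit.NavierStokesRegularity.NavierStokesRegularity.Theorems.PowerGaugeEulerLiouville

end
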